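import Mathlib.Logic.Equiv.Prod
import Literature.Computability.MetaComplexity.RazborovSmolenskyPoly
import HarnessLib

/-!
# Razborov–Smolensky approximation, II: counting the errors, the approximation lemma

Continuation of `RazborovSmolenskyPoly.lean` (groundwork for
`Literature.Computability.Learning.cikk_learn_AC0Mod` via CIKK Thm. 5.3). We count, for each gate and input,
the trial coefficients for which Smolensky's gate polynomial errs on the true argument values,
and derive the **Razborov–Smolensky approximation lemma** (`razborov_smolensky`):

for every prime `p`, every circuit `C` over `accBasis p = {¬, ∧ₖ, ∨ₖ, MOD_{p,k}}` on `n` inputs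
and every `ℓ ≥ 1` there are a polynomial function `P : {0,1}ⁿ → 𝔽_p` of degree at most
`((p-1)ℓ)^{acDepth C}` and an exceptional set `E` with `|E| · p^ℓ ≤ size(C) · 2ⁿ` such that
`P(x) = [C(x)]` for all `x ∉ E` (Smolensky 1987, Lemmas 1–2; Razborov 1987).

Steps:
* NOT and `MOD_p` gates never err (`not_locErr_of_accCode_zero/three`, Fermat's little theorem);
  an OR (resp. AND) gate errs only if some argument is `1` (resp. `0`) and ALL `ℓ` random linear
  forms vanish on the argument vector (`locErr_or`, `locErr_and`);
* a nonzero linear form on `𝔽_p^A` vanishes on exactly `p^{A-1}` vectors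
  (`card_filter_linear_eq_zero_mul`, fibre counting by translation), so at most a `p^{-ℓ}`
  fraction of the local seeds err (`card_locErr_mul_le`);
* summing over gates and inputs and averaging over the global seed
  (`exists_good_seed`): some seed errs on at most `s · 2ⁿ / p^ℓ` inputs.

## References

* R. Smolensky, *Algebraic methods in the theory of lower bounds for Boolean circuit
  complexity*, STOC 1987, Lemmas 1–2 [Smolensky1987].
* M. Carmosino, R. Impagliazzo, V. Kabanets, A. Kolokolova, *Learning algorithms from natural
  proofs*, CCC 2016, §5.2 [CarmosinoImpagliazzoKabanetsKolokolova2016].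
-/

noncomputable section

namespace Literature.Computability.MetaComplexity

open Finset Literature.Computability.Complexity Literature.Computability.Complexity.GateList

namespace Smolensky

open scoped Classical

variable {n : ℕ} {p : ℕ} [Fact p.Prime]

/-! ### Which gates can err -/

section LocalErrors

variable (ℓ : ℕ) (c : ℕ → ℕ → ZMod p)

/-- The truth table of a gate whose gate function is `¬`: arity `1`, negation of the argument.
[folklore] -/
theorem op_eq_not_of_fn_eq_not {g : Gate (Fin n)} (h : g.fn = GateFn.not) :
    ∃ h1 : g.arity = 1, ∀ v, g.op v = !(v ⟨0, by omega⟩) := by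
  obtain ⟨k, op, args⟩ := g
  simp only [Gate.fn, GateFn.not, Sigma.mk.injEq] at h
  obtain ⟨rfl, hop⟩ := h
  simp only [heq_eq_eq] at hop
  subst hop
  exact ⟨rfl, fun v => rfl⟩

/-- NOT gates are represented exactly: no error. [cite: Smolensky1987, Lemma 1] -/
theorem not_locErr_of_accCode_zero (g : Gate (Fin n)) (h0 : accCode p g.fn = 0)
    (v : Fin g.arity → Bool) : ¬ LocErr ℓ c g v := by
  obtain ⟨h1, hop⟩ := op_eq_not_of_fn_eq_not (BT.fn_eq_not_of_accCode h0)
  simp only [LocErr, polyOpL, h0, ↓reduceIte, ne_eq, not_not, hop v]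
  have hsum : ∑ a, bit p (v a) = bit p (v ⟨0, by omega⟩) := by
    rw [Finset.sum_eq_single ⟨0, by omega⟩]
    · intro a _ ha
      exact absurd (Fin.ext (by have := a.isLt; omega)) ha
    · intro h
      exact absurd (Finset.mem_univ _) h
  rw [hsum]
  cases v ⟨0, by omega⟩ <;> simp [bit]

/-- `MOD_p` gates are represented exactly by `(Σ vₐ)^{p-1}` (Fermat): no error.
[cite: Smolensky1987, p. 78 (MOD_p is F-easy)] -/
theorem not_locErr_of_accCode_three (g : Gate (Fin n)) (h3 : accCode p g.fn = 3)
    (v : Fin g.arity → Bool) : ¬ LocErr ℓ c g v := by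
  have hp := (Fact.out : p.Prime)
  have hop := BT.op_mod_of_accCode h3 v
  simp only [LocErr, polyOpL, h3, ne_eq, not_not, hop, show (3 : ℕ) ≠ 0 by decide,
    show (3 : ℕ) ≠ 1 by decide, show (3 : ℕ) ≠ 2 by decide, ↓reduceIte]
  have hsum : (∑ a, bit p (v a)) = (GateFn.numOnes v : ZMod p) := by
    simp only [bit, GateFn.numOnes]
    rw [Finset.sum_boole]
  rw [hsum]
  by_cases hz : (GateFn.numOnes v : ZMod p) = 0
  · have hdvd : p ∣ GateFn.numOnes v := (ZMod.natCast_eq_zero_iff _ _).1 hz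
    have hmod : GateFn.numOnes v % p = 0 := Nat.mod_eq_zero_of_dvd hdvd
    rw [hz, zero_pow (Nat.sub_ne_zero_of_lt hp.one_lt)]
    simp [hmod, bit]
  · have hndvd : ¬ p ∣ GateFn.numOnes v := fun h => hz ((ZMod.natCast_eq_zero_iff _ _).2 h)
    have hmod : GateFn.numOnes v % p ≠ 0 := fun h => hndvd (Nat.dvd_of_mod_eq_zero h)
    rw [ZMod.pow_card_sub_one_eq_one hz]
    simp [hmod, bit]

/-- An OR gate errs only if some argument is true and all `ℓ` linear forms vanish on the
argument vector. [cite: Smolensky1987, Lemma 1] -/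
theorem locErr_or {g : Gate (Fin n)} (h2 : accCode p g.fn = 2) {v : Fin g.arity → Bool}
    (hE : LocErr ℓ c g v) :
    (∃ a, v a = true) ∧ ∀ t ∈ range ℓ, (∑ a : Fin g.arity, c t (a : ℕ) * bit p (v a)) = 0 := by
  have hp := (Fact.out : p.Prime)
  have hop := BT.op_or_of_accCode h2 v
  simp only [LocErr, polyOpL, h2, hop, show (2 : ℕ) ≠ 0 by decide, show (2 : ℕ) ≠ 1 by decide,
    ↓reduceIte, ne_eq] at hE
  by_cases hex : ∃ a, v a = true
  · refine ⟨hex, fun t ht => ?_⟩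
    rw [decide_eq_true hex, bit_true] at hE
    by_contra hne
    apply hE
    rw [Finset.prod_eq_zero ht (by rw [ZMod.pow_card_sub_one_eq_one hne, sub_self]), sub_zero]
  · exfalso
    apply hE
    have h0 : ∀ a, bit p (v a) = 0 := fun a => by
      have : v a = false := by simpa using not_exists.1 hex a
      simp [this]
    simp [h0, hex, zero_pow (Nat.sub_ne_zero_of_lt hp.one_lt)]

/-- An AND gate errs only if some argument is false and all `ℓ` linear forms vanish on the
complemented argument vector. [cite: Smolensky1987, Lemma 1 (Remark: AND via OR and NOT)] -/
theorem locErr_and {g : Gate (Fin n)} (h1 : accCode p g.fn = 1) {v : Fin g.arity → Bool}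
    (hE : LocErr ℓ c g v) :
    (∃ a, v a = false) ∧
      ∀ t ∈ range ℓ, (∑ a : Fin g.arity, c t (a : ℕ) * (1 - bit p (v a))) = 0 := by
  have hp := (Fact.out : p.Prime)
  have hop := BT.op_and_of_accCode h1 v
  simp only [LocErr, polyOpL, h1, hop, show (1 : ℕ) ≠ 0 by decide, ↓reduceIte, ne_eq] at hE
  by_cases hex : ∃ a, v a = false
  · refine ⟨hex, fun t ht => ?_⟩
    have hfalse : decide (∀ a, v a = true) = false := by
      obtain ⟨a, ha⟩ := hex
      simp only [decide_eq_false_iff_not, not_forall]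
      exact ⟨a, by simp [ha]⟩
    rw [hfalse, bit_false] at hE
    by_contra hne
    apply hE
    exact Finset.prod_eq_zero ht (by rw [ZMod.pow_card_sub_one_eq_one hne, sub_self])
  · exfalso
    apply hE
    have hall : ∀ a, v a = true := fun a => by simpa using not_exists.1 hex a
    simp [hall, zero_pow (Nat.sub_ne_zero_of_lt hp.one_lt)]

end LocalErrors

/-! ### Counting: hyperplanes, product sets, one coordinate of a product -/

/-- **A nonzero linear form vanishes on a `1/p` fraction of the vectors**: for an injection
`e : Fin k ↪ Fin A` and weights `w` with some `w a₀ ≠ 0`,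
`#{c : 𝔽_p^A | Σₐ c(e a) wₐ = 0} · p = p^A` (all fibres of the form are translates of one
another). [folklore] -/
theorem card_filter_linear_eq_zero_mul {A k : ℕ} (e : Fin k → Fin A) (he : Function.Injective e)
    (w : Fin k → ZMod p) (a₀ : Fin k) (ha₀ : w a₀ ≠ 0) :
    (univ.filter fun c : Fin A → ZMod p => (∑ a, c (e a) * w a) = 0).card * p = p ^ A := by
  -- translating by a multiple of the `e a₀`-th unit vector shifts the form
  have hshift : ∀ (c : Fin A → ZMod p) (s : ZMod p),
      (∑ a, (c + Pi.single (e a₀) s : Fin A → ZMod p) (e a) * w a) =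
        (∑ a, c (e a) * w a) + s * w a₀ := by
    intro c s
    simp only [Pi.add_apply, add_mul, Finset.sum_add_distrib]
    congr 1
    rw [Finset.sum_eq_single a₀]
    · rw [Pi.single_eq_same]
    · intro a _ ha
      rw [Pi.single_eq_of_ne (fun h => ha (he h)), zero_mul]
    · intro h
      exact absurd (Finset.mem_univ a₀) h
  -- all fibres have the cardinality of the zero fibre
  have hfib : ∀ y : ZMod p, (univ.filter fun c : Fin A → ZMod p => (∑ a, c (e a) * w a) = y).card =
      (univ.filter fun c : Fin A → ZMod p => (∑ a, c (e a) * w a) = 0).card := by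
    intro y
    symm
    refine Finset.card_equiv (Equiv.addRight (Pi.single (e a₀) (y * (w a₀)⁻¹))) fun c => ?_
    simp only [Finset.mem_filter, Finset.mem_univ, true_and, Equiv.coe_addRight, hshift,
      inv_mul_cancel_right₀ ha₀]
    constructor
    · intro h
      rw [h, zero_add]
    · intro h
      simpa using h
  have htot : (univ : Finset (Fin A → ZMod p)).card =
      ∑ y ∈ (univ : Finset (ZMod p)),
        (univ.filter fun c : Fin A → ZMod p => (∑ a, c (e a) * w a) = y).card :=
    Finset.card_eq_sum_card_fiberwise fun c _ => Finset.mem_univ _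
  rw [Finset.sum_congr rfl fun y _ => hfib y, Finset.sum_const, smul_eq_mul] at htot
  simp only [Finset.card_univ, ZMod.card, Fintype.card_fun, Fintype.card_fin] at htot
  rw [htot, Nat.mul_comm]

/-- Product sets in a power: `#{c : Fin ℓ → β | ∀ t, c t ∈ S} = |S|^ℓ`. [folklore] -/
theorem card_filter_forall_mem {β : Type*} [Fintype β] [DecidableEq β] (S : Finset β) (ℓ : ℕ) :
    (univ.filter fun c : Fin ℓ → β => ∀ t, c t ∈ S).card = S.card ^ ℓ := by
  rw [← Fintype.card_subtype]
  rw [Fintype.card_congr (Equiv.subtypePiEquivPi (p := fun _ b => b ∈ S))]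
  simp

/-- One coordinate of a product: `#{ω : Fin s → β | P (ω j)} · |β| = #{b | P b} · |β^s|`.
[folklore] -/
theorem card_filter_apply_mul {β : Type*} [Fintype β] {s : ℕ} (j : Fin s) (P : β → Prop)
    [DecidablePred P] :
    (univ.filter fun ω : Fin s → β => P (ω j)).card * Fintype.card β =
      (univ.filter P).card * Fintype.card (Fin s → β) := by
  classical
  have h1 : (univ.filter fun ω : Fin s → β => P (ω j)).card =
      ((univ.filter P) ×ˢ (univ : Finset ({k // k ≠ j} → β))).card := by
    refine Finset.card_equiv (Equiv.funSplitAt j β) fun ω => ?_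
    simp [Equiv.funSplitAt, Equiv.piSplitAt]
  have h2 : Fintype.card (Fin s → β) = Fintype.card β * Fintype.card ({k // k ≠ j} → β) := by
    rw [Fintype.card_congr (Equiv.funSplitAt j β), Fintype.card_prod]
  rw [h1, h2, Finset.card_product, Finset.card_univ]
  ring

/-! ### The local seed space and the error count of one gate -/

/-- Reading local trial coefficients `c : Fin ℓ → Fin A → 𝔽_p` at arbitrary positions (zero
outside the range). [folklore] -/
def lreader {ℓ A : ℕ} (c : Fin ℓ → Fin A → ZMod p) : ℕ → ℕ → ZMod p :=
  fun t a => if h : t < ℓ ∧ a < A then c ⟨t, h.1⟩ ⟨a, h.2⟩ else 0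

/-- In range, `lreader` reads the coefficient. [folklore] -/
theorem lreader_apply {ℓ A : ℕ} (c : Fin ℓ → Fin A → ZMod p) (t : Fin ℓ) {k : ℕ} (hk : k ≤ A)
    (a : Fin k) : lreader c t a = c t (Fin.castLE hk a) := by
  simp [lreader, t.isLt, lt_of_lt_of_le a.isLt hk, Fin.castLE]

/-- **At most a `p^{-ℓ}` fraction of the local seeds err at a gate of `accBasis p`**
(Smolensky 1987, Lemma 1: error `≤ |F|^{-l}` per gate). [cite: Smolensky1987, Lemma 1] -/
theorem card_locErr_mul_le (ℓ A : ℕ) (g : Gate (Fin n)) (hg : g.fn ∈ accBasis p)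
    (hA : g.arity ≤ A) (v : Fin g.arity → Bool) :
    (univ.filter fun c : Fin ℓ → Fin A → ZMod p => LocErr ℓ (lreader c) g v).card * p ^ ℓ ≤
      Fintype.card (Fin ℓ → Fin A → ZMod p) := by
  classical
  have hcode := BT.accCode_le_three hg
  -- the vanishing condition for weights `w` with a nonzero entry gives the bound
  have key : ∀ (w : Fin g.arity → ZMod p) (a₀ : Fin g.arity), w a₀ ≠ 0 →
      (∀ c : Fin ℓ → Fin A → ZMod p, LocErr ℓ (lreader c) g v →
        ∀ t ∈ range ℓ, (∑ a : Fin g.arity, lreader c t (a : ℕ) * w a) = 0) →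
      (univ.filter fun c : Fin ℓ → Fin A → ZMod p => LocErr ℓ (lreader c) g v).card * p ^ ℓ ≤
        Fintype.card (Fin ℓ → Fin A → ZMod p) := by
    intro w a₀ ha₀ himp
    set S : Finset (Fin A → ZMod p) :=
      univ.filter fun c' => (∑ a, c' (Fin.castLE hA a) * w a) = 0 with hS
    have hsub : (univ.filter fun c : Fin ℓ → Fin A → ZMod p => LocErr ℓ (lreader c) g v) ⊆
        univ.filter fun c : Fin ℓ → Fin A → ZMod p => ∀ t, c t ∈ S := by
      intro c hc
      simp only [Finset.mem_filter, Finset.mem_univ, true_and] at hc ⊢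
      intro t
      simp only [hS, Finset.mem_filter, Finset.mem_univ, true_and]
      have h := himp c hc t (Finset.mem_range.2 t.isLt)
      simpa [lreader_apply c t hA] using h
    have hScard : S.card * p = p ^ A :=
      card_filter_linear_eq_zero_mul (Fin.castLE hA) (Fin.castLE_injective hA) w a₀ ha₀
    calc (univ.filter fun c : Fin ℓ → Fin A → ZMod p => LocErr ℓ (lreader c) g v).card * p ^ ℓ
        ≤ (univ.filter fun c : Fin ℓ → Fin A → ZMod p => ∀ t, c t ∈ S).card * p ^ ℓ :=
          Nat.mul_le_mul_right _ (Finset.card_le_card hsub)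
      _ = (S.card * p) ^ ℓ := by rw [card_filter_forall_mem, mul_pow]
      _ = Fintype.card (Fin ℓ → Fin A → ZMod p) := by
          rw [hScard, Fintype.card_fun, Fintype.card_fun, ZMod.card, Fintype.card_fin,
            Fintype.card_fin]
  -- no error at all for NOT / MOD gates
  have triv : (∀ c : Fin ℓ → Fin A → ZMod p, ¬ LocErr ℓ (lreader c) g v) →
      (univ.filter fun c : Fin ℓ → Fin A → ZMod p => LocErr ℓ (lreader c) g v).card * p ^ ℓ ≤
        Fintype.card (Fin ℓ → Fin A → ZMod p) := by
    intro h
    rw [Finset.filter_eq_empty_iff.2 fun c _ => h c, Finset.card_empty, zero_mul]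
    exact Nat.zero_le _
  by_cases h0 : accCode p g.fn = 0
  · exact triv fun c => not_locErr_of_accCode_zero ℓ (lreader c) g h0 v
  by_cases h3 : accCode p g.fn = 3
  · exact triv fun c => not_locErr_of_accCode_three ℓ (lreader c) g h3 v
  by_cases h2 : accCode p g.fn = 2
  · -- OR
    by_cases hex : ∃ a, v a = true
    · obtain ⟨a₀, ha₀⟩ := hex
      refine key (fun a => bit p (v a)) a₀ (by simp [ha₀]) fun c hc => (locErr_or ℓ _ h2 hc).2
    · exact triv fun c hc => hex (locErr_or ℓ _ h2 hc).1
  · -- AND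
    have h1 : accCode p g.fn = 1 := by omega
    by_cases hex : ∃ a, v a = false
    · obtain ⟨a₀, ha₀⟩ := hex
      refine key (fun a => 1 - bit p (v a)) a₀ (by simp [ha₀]) fun c hc => (locErr_and ℓ _ h1 hc).2
    · exact triv fun c hc => hex (locErr_and ℓ _ h1 hc).1

/-! ### The global seed and the approximation lemma -/

/-- The seed reader of a global seed `ω : Fin s → Fin ℓ → Fin A → 𝔽_p` (gate `j` reads `ω j`).
[folklore] -/
def reader {s ℓ A : ℕ} (ω : Fin s → Fin ℓ → Fin A → ZMod p) : Seed p :=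
  fun j t a => if h : j < s then lreader (ω ⟨j, h⟩) t a else 0

/-- Gate `j < s` reads its own local seed. [folklore] -/
theorem reader_apply {s ℓ A : ℕ} (ω : Fin s → Fin ℓ → Fin A → ZMod p) (j : Fin s) :
    reader ω j = lreader (ω j) := by
  funext t a
  simp [reader, j.isLt]

/-- **Some seed errs on few inputs** (Smolensky 1987, Lemma 2: union bound over the `s` gates
and averaging over the seed): there is a global seed for which the inputs at which some gate
polynomial errs number at most `s · 2ⁿ / p^ℓ`. [cite: Smolensky1987, Lemma 2] -/
theorem exists_good_seed (C : Circuit (Fin n)) (hC : C.IsOver (accBasis p)) (ℓ : ℕ) :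
    ∃ ω : Fin C.gates.length → Fin ℓ → Fin C.maxFanIn → ZMod p,
      (univ.filter fun x : Fin n → Bool =>
          ∃ j, j < C.gates.length ∧ GateErr ℓ (reader ω) C x j).card * p ^ ℓ ≤
        C.gates.length * 2 ^ n := by
  classical
  set s := C.gates.length with hs
  set L : Type := Fin ℓ → Fin C.maxFanIn → ZMod p with hL
  -- per gate and input: few global seeds err
  have hloc : ∀ (j : Fin s) (x : Fin n → Bool),
      (univ.filter fun ω : Fin s → L => GateErr ℓ (reader ω) C x j).card * p ^ ℓ ≤
        Fintype.card (Fin s → L) := by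
    intro j x
    have hj : (j : ℕ) < C.gates.length := j.isLt
    have hiff : ∀ ω : Fin s → L, GateErr ℓ (reader ω) C x j ↔
        LocErr ℓ (lreader (ω j)) C.gates[(j : ℕ)] (trueArgs C x j hj) := by
      intro ω
      rw [← reader_apply ω j]
      exact ⟨fun ⟨_, h⟩ => h, fun h => ⟨hj, h⟩⟩
    have hP := card_locErr_mul_le ℓ C.maxFanIn C.gates[(j : ℕ)] (hC _ (List.getElem_mem hj))
      (BT.arity_le_maxFanIn C (List.getElem_mem hj)) (trueArgs C x j hj)
    have hcoord := card_filter_apply_mul j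
      (fun c : L => LocErr ℓ (lreader c) C.gates[(j : ℕ)] (trueArgs C x j hj))
    rw [Finset.filter_congr fun ω _ => hiff ω]
    have hLpos : 0 < Fintype.card L := Fintype.card_pos
    refine Nat.le_of_mul_le_mul_left ?_ hLpos
    calc Fintype.card L * ((univ.filter fun ω : Fin s → L =>
            LocErr ℓ (lreader (ω j)) C.gates[(j : ℕ)] (trueArgs C x j hj)).card * p ^ ℓ)
        = (univ.filter fun c : L =>
            LocErr ℓ (lreader c) C.gates[(j : ℕ)] (trueArgs C x j hj)).card * p ^ ℓ *
            Fintype.card (Fin s → L) := by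
          rw [← mul_assoc, mul_comm (Fintype.card L), hcoord]
          ring
      _ ≤ Fintype.card L * Fintype.card (Fin s → L) := Nat.mul_le_mul_right _ hP
  -- averaging
  by_contra hall
  push Not at hall
  have hsum : ∀ ω : Fin s → L,
      (univ.filter fun x : Fin n → Bool => ∃ j, j < s ∧ GateErr ℓ (reader ω) C x j).card ≤
        ∑ j : Fin s, (univ.filter fun x : Fin n → Bool => GateErr ℓ (reader ω) C x j).card := by
    intro ω
    refine (Finset.card_le_card ?_).trans Finset.card_biUnion_le
    intro x hx
    simp only [Finset.mem_filter, Finset.mem_univ, true_and] at hx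
    obtain ⟨j, hj, hE⟩ := hx
    exact Finset.mem_biUnion.2 ⟨⟨j, hj⟩, Finset.mem_univ _, by simpa using hE⟩
  have htotal : ∑ ω : Fin s → L, (univ.filter fun x : Fin n → Bool =>
      ∃ j, j < s ∧ GateErr ℓ (reader ω) C x j).card * p ^ ℓ ≤
        s * 2 ^ n * Fintype.card (Fin s → L) := by
    calc ∑ ω : Fin s → L, (univ.filter fun x : Fin n → Bool =>
          ∃ j, j < s ∧ GateErr ℓ (reader ω) C x j).card * p ^ ℓ
        ≤ ∑ ω : Fin s → L, (∑ j : Fin s,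
            (univ.filter fun x : Fin n → Bool => GateErr ℓ (reader ω) C x j).card) * p ^ ℓ :=
          Finset.sum_le_sum fun ω _ => Nat.mul_le_mul_right _ (hsum ω)
      _ = ∑ j : Fin s, ∑ x : Fin n → Bool,
            (univ.filter fun ω : Fin s → L => GateErr ℓ (reader ω) C x j).card * p ^ ℓ := by
          simp only [Finset.card_filter, Finset.sum_mul]
          rw [Finset.sum_comm]
          refine Finset.sum_congr rfl fun j _ => ?_
          rw [Finset.sum_comm]
      _ ≤ ∑ _j : Fin s, ∑ _x : Fin n → Bool, Fintype.card (Fin s → L) :=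
          Finset.sum_le_sum fun j _ => Finset.sum_le_sum fun x _ => hloc j x
      _ = s * 2 ^ n * Fintype.card (Fin s → L) := by
          simp only [Finset.sum_const, smul_eq_mul, Finset.card_univ, Fintype.card_fun,
            Fintype.card_bool, Fintype.card_fin]
          ring
  have hlower : ∑ ω : Fin s → L, (s * 2 ^ n + 1) ≤ ∑ ω : Fin s → L,
      (univ.filter fun x : Fin n → Bool => ∃ j, j < s ∧ GateErr ℓ (reader ω) C x j).card * p ^ ℓ :=
    Finset.sum_le_sum fun ω _ => hall ω
  rw [Finset.sum_const, smul_eq_mul, Finset.card_univ] at hlower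
  have hpos : 0 < Fintype.card (Fin s → L) := Fintype.card_pos
  nlinarith [hlower.trans htotal]

/-- **The Razborov–Smolensky approximation lemma.** For a prime `p`, a circuit `C` over
`accBasis p = {¬, ∧ₖ, ∨ₖ, MOD_{p,k} : k ∈ ℕ}` on `n` inputs, and `ℓ ≥ 1`, there are a function
`P : {0,1}ⁿ → 𝔽_p` of degree at most `((p-1)ℓ)^{acDepth C}` (`P ∈ lowDeg`) and an exceptional set
`E` of inputs with `|E| · p^ℓ ≤ size(C) · 2ⁿ`, such that `P(x) = [C(x)] ∈ {0,1}` for every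
`x ∉ E` (Smolensky 1987, Lemma 2 with Lemma 1: "the output of `Cₙ` can be approximated by a low
degree polynomial if we ignore just a small fraction of assignments").
[cite: Smolensky1987, Lemmas 1–2] -/
theorem razborov_smolensky (C : Circuit (Fin n)) (hC : C.IsOver (accBasis p)) {ℓ : ℕ}
    (hℓ : 1 ≤ ℓ) :
    ∃ (P : CubeFn (ZMod p) n) (E : Finset (Fin n → Bool)),
      P ∈ lowDeg (ZMod p) n (((p - 1) * ℓ) ^ C.acDepth) ∧ E.card * p ^ ℓ ≤ C.size * 2 ^ n ∧
        ∀ x, x ∉ E → P x = bit p (C.eval x) := by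
  classical
  obtain ⟨ω, hω⟩ := exists_good_seed C hC ℓ
  refine ⟨apx ℓ (reader ω) C,
    univ.filter fun x : Fin n → Bool => ∃ j, j < C.gates.length ∧ GateErr ℓ (reader ω) C x j,
    apx_mem_lowDeg ℓ hℓ _ C, hω, fun x hx => ?_⟩
  refine apx_eq_bit_eval ℓ _ C x fun j hj hE => hx ?_
  simp only [Finset.mem_filter, Finset.mem_univ, true_and]
  exact ⟨j, hj, hE⟩

end Smolensky

end Literature.Computability.MetaComplexity
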